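import Summits.Ventures.PercRepro.ThetaSigmaCopair
import Summits.Ventures.PercRepro.ThetaSigmaCredit

/-!
# (Σ) reduces to the DENSE instances: a point with at most one partner pair is always good

Dossier proofs/MINE1-theoremS.md, Addendum 79 (mine-1, gen 40). The partner pairs of a
(Σ)-instance at a point `e` are the consistent pairs (`partS e X`), the **co-pairs** (two
`e`-free members partitioning `U ∖ e`; their members form `copairMembersAt U e X`) and the
**co-co-pairs** (two members containing `e` with meet `{e}` and union `U`; members
`cocopairMembersAt U e X`). `AtMostOnePartnerAt U e X` says there is at most one partner pair.

* `copair_or_cocopair_of_mem_projS` — a complementary pair of the projection `projS e X` comes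
  from a co-pair or a co-co-pair (the mixed case would be a member together with its complement);
* `disjoint_complsRel_erase_of_unique` — erasing the partner of the unique complementary pair
  of the projection leaves a valid family; `sigmaConsistentAt_of_no_copair` — a point without
  co-pairs and co-co-pairs is sign-consistent.
The reduction itself (`exists_orient_of_atMostOnePartner`, `SigmaCreditLemmaDense`,
`conjSigma_of_denseCreditLemma`) is `ThetaSigmaDenseMain.lean`.
-/

namespace PercRepro.MSTight

open Finset

variable {α : Type*} [DecidableEq α]

section PartnerDefs

variable {U : Finset α} {e : α} {X : Finset (Finset α)}

/-- The members of the **co-pairs** at `e`: `e`-free members whose relative complement in `U ∖ e`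
is a member. -/
def copairMembersAt (U : Finset α) (e : α) (X : Finset (Finset α)) : Finset (Finset α) :=
  X.filter fun x => e ∉ x ∧ U.erase e \ x ∈ X

/-- The members of the **co-co-pairs** at `e`: members containing `e` whose partner
`(U ∖ x) + e` is a member. -/
def cocopairMembersAt (U : Finset α) (e : α) (X : Finset (Finset α)) : Finset (Finset α) :=
  X.filter fun x => e ∈ x ∧ insert e (U \ x) ∈ X

/-- **At most one partner pair at `e`**: at most one consistent pair and nothing else, or at most
one co-pair and nothing else, or at most one co-co-pair and nothing else. -/
def AtMostOnePartnerAt (U : Finset α) (e : α) (X : Finset (Finset α)) : Prop :=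
  ((partS e X).card ≤ 1 ∧ copairMembersAt U e X = ∅ ∧ cocopairMembersAt U e X = ∅) ∨
  (partS e X = ∅ ∧ (copairMembersAt U e X).card ≤ 2 ∧ cocopairMembersAt U e X = ∅) ∨
  (partS e X = ∅ ∧ copairMembersAt U e X = ∅ ∧ (cocopairMembersAt U e X).card ≤ 2)

/-- Membership in the co-pair members. -/
theorem mem_copairMembersAt {x : Finset α} :
    x ∈ copairMembersAt U e X ↔ x ∈ X ∧ e ∉ x ∧ U.erase e \ x ∈ X := by
  unfold copairMembersAt
  rw [mem_filter]

/-- Membership in the co-co-pair members. -/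
theorem mem_cocopairMembersAt {x : Finset α} :
    x ∈ cocopairMembersAt U e X ↔ x ∈ X ∧ e ∈ x ∧ insert e (U \ x) ∈ X := by
  unfold cocopairMembersAt
  rw [mem_filter]

/-- The co-pair partner of a co-pair member is a co-pair member. -/
theorem sdiff_mem_copairMembersAt {x : Finset α} (hxU : x ⊆ U) (hx : x ∈ copairMembersAt U e X) :
    U.erase e \ x ∈ copairMembersAt U e X := by
  rw [mem_copairMembersAt] at hx ⊢
  refine ⟨hx.2.2, ?_, ?_⟩
  · simp only [mem_sdiff, mem_erase, ne_eq, not_true_eq_false, false_and, not_false_eq_true]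
  · rw [Finset.sdiff_sdiff_eq_self (subset_erase.2 ⟨hxU, hx.2.1⟩)]
    exact hx.1

/-- The co-co-pair partner of a co-co-pair member is a co-co-pair member. -/
theorem insert_sdiff_mem_cocopairMembersAt {x : Finset α} (hxU : x ⊆ U)
    (hx : x ∈ cocopairMembersAt U e X) : insert e (U \ x) ∈ cocopairMembersAt U e X := by
  rw [mem_cocopairMembersAt] at hx ⊢
  refine ⟨hx.2.2, mem_insert_self e _, ?_⟩
  have : U \ insert e (U \ x) = x.erase e := by
    ext a
    simp only [mem_sdiff, mem_insert, not_or, mem_erase]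
    constructor
    · rintro ⟨haU, hae, h⟩
      exact ⟨hae, by_contra fun hax => h ⟨haU, hax⟩⟩
    · rintro ⟨hae, hax⟩
      exact ⟨hxU hax, hae, fun h => h.2 hax⟩
  rw [this, insert_erase hx.2.1]
  exact hx.1

/-- A co-pair member is not its own partner (when `∅ ∉ X`). -/
theorem ne_sdiff_of_mem_copairMembersAt (h0 : (∅ : Finset α) ∉ X) {x : Finset α}
    (hx : x ∈ copairMembersAt U e X) : x ≠ U.erase e \ x := by
  intro h
  apply h0
  have hx' := (mem_copairMembersAt.1 hx).1
  have : x = ∅ := by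
    rw [eq_empty_iff_forall_notMem]
    intro a ha
    have ha' := ha
    rw [h, mem_sdiff] at ha'
    exact ha'.2 ha
  rwa [this] at hx'

/-- A co-co-pair member is not its own partner (when `U ∉ X`). -/
theorem ne_insert_sdiff_of_mem_cocopairMembersAt (hUX : U ∉ X) {x : Finset α}
    (hxU : x ⊆ U) (hx : x ∈ cocopairMembersAt U e X) : x ≠ insert e (U \ x) := by
  intro h
  apply hUX
  have hx' := (mem_cocopairMembersAt.1 hx).1
  have : x = U := by
    apply Finset.Subset.antisymm hxU
    intro a ha
    by_cases hae : a = e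
    · exact hae ▸ (mem_cocopairMembersAt.1 hx).2.1
    · by_contra hax
      have : a ∈ insert e (U \ x) := mem_insert_of_mem (mem_sdiff.2 ⟨ha, hax⟩)
      rw [← h] at this
      exact hax this
  rwa [this] at hx'

end PartnerDefs

section Projection

variable {U : Finset α} {e : α} {X : Finset (Finset α)}

/-- **Complementary pairs of the projection come from co-pairs or co-co-pairs**: if `t` and
`U ∖ e ∖ t` are both in the projection of a valid instance, then `t` is a co-pair member or
`t + e` is a co-co-pair member. -/
theorem copair_or_cocopair_of_mem_projS (hv : SigmaValidRel U X) (hU : e ∈ U) {t : Finset α}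
    (ht : t ∈ projS e X) (ht' : U.erase e \ t ∈ projS e X) :
    t ∈ copairMembersAt U e X ∨ insert e t ∈ cocopairMembersAt U e X := by
  obtain ⟨u, hu, rfl⟩ := mem_projS.1 ht
  obtain ⟨v, hv', hv'e⟩ := mem_projS.1 ht'
  have key : ∀ a, a ∈ v.erase e ↔ a ∈ U.erase e \ u.erase e := fun a => by rw [hv'e]
  simp only [mem_erase, mem_sdiff, not_and] at key
  by_cases heu : e ∈ u <;> by_cases hev : e ∈ v
  · -- both contain `e`: a co-co-pair
    right
    rw [insert_erase heu, mem_cocopairMembersAt]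
    refine ⟨hu, heu, ?_⟩
    have : insert e (U \ u) = v := by
      ext a
      simp only [mem_insert, mem_sdiff]
      by_cases hae : a = e
      · subst hae
        simp only [true_or, true_iff]
        exact hev
      · simp only [hae, false_or]
        have k := key a
        constructor
        · rintro ⟨haU, hau⟩
          exact (k.2 ⟨⟨hae, haU⟩, fun _ => hau⟩).2
        · intro hav
          obtain ⟨⟨-, haU⟩, h⟩ := k.1 ⟨hae, hav⟩
          exact ⟨haU, fun hau => h hae hau⟩
    rw [this]
    exact hv'
  · -- `e ∈ u`, `e ∉ v`: `v = U \ u`, contradicting validity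
    exfalso
    have : v = U \ u := by
      ext a
      simp only [mem_sdiff]
      by_cases hae : a = e
      · subst hae
        exact ⟨fun h => absurd h hev, fun h => absurd heu h.2⟩
      · have k := key a
        constructor
        · intro hav
          obtain ⟨⟨-, haU⟩, h⟩ := k.1 ⟨hae, hav⟩
          exact ⟨haU, fun hau => h hae hau⟩
        · rintro ⟨haU, hau⟩
          exact (k.2 ⟨⟨hae, haU⟩, fun _ => hau⟩).2
    exact sdiff_notMem_of_sigmaValidRel hv hu (this ▸ hv')
  · -- `e ∉ u`, `e ∈ v`: `v = U \ u`, contradicting validity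
    exfalso
    have : v = U \ u := by
      ext a
      simp only [mem_sdiff]
      by_cases hae : a = e
      · subst hae
        exact ⟨fun _ => ⟨hU, heu⟩, fun _ => hev⟩
      · have k := key a
        constructor
        · intro hav
          obtain ⟨⟨-, haU⟩, h⟩ := k.1 ⟨hae, hav⟩
          exact ⟨haU, fun hau => h hae hau⟩
        · rintro ⟨haU, hau⟩
          exact (k.2 ⟨⟨hae, haU⟩, fun _ => hau⟩).2
    exact sdiff_notMem_of_sigmaValidRel hv hu (this ▸ hv')
  · -- neither contains `e`: a co-pair
    left
    rw [erase_eq_of_notMem heu, mem_copairMembersAt]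
    refine ⟨hu, heu, ?_⟩
    have : U.erase e \ u = v := by
      rw [← erase_eq_of_notMem heu, ← hv'e, erase_eq_of_notMem hev]
    rw [this]
    exact hv'

/-- A co-pair member is in the projection (as itself). -/
theorem mem_projS_of_mem_copairMembersAt {x : Finset α} (hx : x ∈ copairMembersAt U e X) :
    x ∈ projS e X := by
  rw [mem_copairMembersAt] at hx
  exact mem_projS.2 ⟨x, hx.1, erase_eq_of_notMem hx.2.1⟩

/-- The projection of a co-co-pair member's partner is the relative complement of its own
projection. -/
theorem erase_insert_sdiff_eq (U : Finset α) (e : α) (z : Finset α) :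
    (insert e (U \ z)).erase e = U.erase e \ z.erase e := by
  ext a
  simp only [mem_erase, mem_insert, mem_sdiff, not_and]
  constructor
  · rintro ⟨hae, h | ⟨haU, haz⟩⟩
    · exact absurd h hae
    · exact ⟨⟨hae, haU⟩, fun _ => haz⟩
  · rintro ⟨⟨hae, haU⟩, h⟩
    exact ⟨hae, Or.inr ⟨haU, h hae⟩⟩

end Projection

section Orient

variable {U : Finset α} {e : α} {X : Finset (Finset α)}

/-- Erasing the partner of the unique complementary pair of the projection leaves a valid
family: if every complementary pair of the projection is `{w, U ∖ e ∖ w}`, then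
`projS e X ∖ {U ∖ e ∖ w}` has no complementary pair. -/
theorem disjoint_complsRel_erase_of_unique (w : Finset α)
    (hw : ∀ s ∈ projS e X, U.erase e \ s ∈ projS e X → s = w ∨ s = U.erase e \ w) :
    Disjoint ((projS e X).erase (U.erase e \ w))
      (complsRel (U.erase e) ((projS e X).erase (U.erase e \ w))) := by
  rw [disjoint_left]
  intro t ht ht'
  obtain ⟨s, hs, rfl⟩ := mem_complsRel.1 ht'
  have hsP := mem_of_mem_erase hs
  have hsw := ne_of_mem_erase hs
  have htP := mem_of_mem_erase ht
  have htw := ne_of_mem_erase ht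
  rcases hw s hsP htP with rfl | rfl
  · exact htw rfl
  · exact hsw rfl

/-- The projection is valid at a point without co-pairs and co-co-pairs. -/
theorem sigmaConsistentAt_of_no_copair (hv : SigmaValidRel U X)
    (hc : copairMembersAt U e X = ∅) (hcc : cocopairMembersAt U e X = ∅) :
    SigmaConsistentAt U e X := by
  intro x hx y hy hxy
  have hxP : x.erase e ∈ projS e X := mem_projS.2 ⟨x, hx, rfl⟩
  have hyP : U.erase e \ x.erase e ∈ projS e X := hxy ▸ mem_projS.2 ⟨y, hy, rfl⟩
  have hU : e ∈ U := by
    by_contra hU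
    -- with `e ∉ U` the relative complement is in `U` while `y` is in `U`: fine; we need `e ∈ U`
    -- only for `copair_or_cocopair_of_mem_projS`; derive it from the members being inside `U`
    -- is impossible in general, so handle `e ∉ U` directly: then `x.erase e = x`, `y.erase e = y`
    have hxU := hv.1 x hx
    have hyU := hv.1 y hy
    have hex : e ∉ x := fun h => hU (hxU h)
    have hey : e ∉ y := fun h => hU (hyU h)
    rw [erase_eq_of_notMem hex, erase_eq_of_notMem hey, erase_eq_of_notMem hU] at hxy
    exact sdiff_notMem_of_sigmaValidRel hv hx (hxy ▸ hy)
  rcases copair_or_cocopair_of_mem_projS hv hU hxP hyP with h | h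
  · rw [hc] at h
    exact notMem_empty _ h
  · rw [hcc] at h
    exact notMem_empty _ h

end Orient

end PercRepro.MSTight
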